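import Summits.Ventures.CertifiedManyBodySolver.Theorems.M3x2EdgeSplitSymReplayGramRShardsFast
import Summits.Ventures.CertifiedManyBodySolver.Theorems.M3x2EdgeSplitSymReplayLocalB
import HarnessLib

/-!
# SymReplay gramR — LOCAL base and GROUPED R-shards (the v0′ path of record, crit-1 V105 (ii))
(pen hub-lb-sym-plan-1 g2, 2026-08-28; ADDITIVE module = sections (f)–(i) of the crux workfile `GramRShardsFast_symplan1.lean` rev 3
(sha16 0bff438c521d194e), whose sections (a)–(e) ARE the landed `…SymReplayGramRShardsFast` (hub-lb-sym-eng-3, 12:56Z) — nothing landed is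
touched or restated; imports only the tree (`…GramRShardsFast` ← `…GramRShards`, `…LocalB` ← `…LocalA` (T16, hub-lb-sym-eng-3)); one-writer rule.)

CONTENTS.
* §(f) LOCAL base (T16 `rhsPolyL`, zero-filtered pipe `canonNFZV`) under the R-blocks: `wellFormed_toSymCert_of_expand`, `shardPolysRL K c :=
  shardPolysL K.toSymCert c ++ R-chunks`, `sum_shardPolysRL`, `shardPolyAtRLFast` (+ `_eq`), `shardCountR_eq_lengthRL`, `shardOKRLV` / `ShardFactsRLV` /
  `facts₂Z_of_shardFactsRLV` (T16b's `Facts₂Z`, `facts₂Z_sum` reused by name); the GENERIC soundness theorem **`wardD4CertGe_of_facts₂ZR`** (any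
  frame-supported shard list `Qs` with Σ polyOp = LHS − RHS_R on frame-containing windows + `Facts₂Z K.toSymCert Qs Ps` + zero final canon ⇒
  `WardD4CertGe (symValueR K)`; proof = the `…GramRShards` assembly with `canonNFZUses` and the local base), `supp_of_gramROK`, `PSupp_shardPolysL`,
  and its corollaries **`wardD4CertGe_of_shardsRLV`** / `energyDensity_ge_of_shardsRLV`;
* §(g) `toyRCert` END TO END through the local sharded R-pipe (`toyRCert_energy_ge_local`, kernel only) + non-vacuity control;
* §(h) GROUPED R-shards (the byte lever — hub-lb-sym-plan-1 PARTIALS-BYTES: shipped partial literals dominate a sharded landing's bytes and fall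
  steeply with FEWER shards): `splitRuns sizes K.gramR` (runs of consecutive R-blocks of the shipped lengths, remainder = last run; `flatten_splitRuns`
  needs no side condition; the converter orders the blocks, so runs realise any grouping), `runAt`, `groupShardR c run` (a run's representative chunks
  concatenated = ONE shard, ONE partial), `shardPolysRG K c sizes := shardPolysL K.toSymCert c ++ runs.map (groupShardR c)`, `sum_shardPolysRG`,
  `shardPolyAtRGFast` (+ `_eq`), `shardCountRG` (+ `_eq`), `shardOKRGV` / `ShardFactsRGV` / `facts₂Z_of_shardFactsRGV`, **`wardD4CertGe_of_shardsRGV`** /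
  `energyDensity_ge_of_shardsRGV`;
* §(i) `toyRCert` through the grouped pipe with `sizes = [1]` (three shards) and `sizes = []` (ONE Gram group, two shards), kernel `decide`.

MULTI-CALL CLOSING GRAMMAR (grouped, executed path) for an R-literal `K := decodeSymCertR (toks certS) (toks gramRS)` (su2R: `(decodeSymCertS …).lower`):
literal `sizes : List ℕ` = run lengths over the shipped R-block order (`J = sizes.length + 1` Gram shards; v0′: J = 3 with AV canon, J = 2 with box canon);
per shard `j < shardCountRG K c sizes` one theorem `shard_j : shardOKRGV K c sizes j P_j = true := by native_decide` (shard 0 = the T16 base, ≈ 385 s on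
v0′; shards 1 … J = block groups); per R-block `i` `rok_i : gramROKAt K i = true := by native_decide` (several per module); then `hwf : wellFormed
K.expand = true`, `hn : K.gramR.length = n`, `hcount : shardCountRG K c sizes = m + 1` (cheap), `hRok := gramR_all_of_facts K n hn ⟨rok_0, …, trivial⟩`,
`hfacts : ShardFactsRGV K c sizes 0 [P₀, …, P_m] := ⟨shard_0, …, shard_m, trivial⟩`, `hfin : isZero (canonNFZV K.frame [P₀, …].flatten) = true` (one
call), and `energyDensity_ge_of_shardsRGV K hwf hRok c sizes [P₀, …] hcount hfacts hfin` (or `wardD4CertGe_of_shardsRGV …` into the crux's door (iii),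
`Cruxes/…/Lines/symreplay.lean` rev 11).  Ungrouped local form: `shardOKRLV / ShardFactsRLV / shardCountR / energyDensity_ge_of_shardsRLV`.

HONEST FRAMING: plumbing for a checker COST/BYTE lever; no certificate beyond the toy is replayed; no bound of record moves; no summit or crux
statement is proved here; nothing here predicts superconductivity.
-/

noncomputable section

namespace Summit.Ventures.CertifiedManyBodySolver.Theorems.SymReplay

open Matrix Finset
open Literature.MathematicalPhysics.QuantumLattice
open Literature.MathematicalPhysics.QuantumLattice.HubbardWave0
open Literature.MathematicalPhysics.QuantumLattice.ThermodynamicLimit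
open Literature.Probability.LatticeModels
open Literature.MathematicalPhysics.QuantumManyBody.StateRelaxation
open Summit.Ventures.CertifiedManyBodySolver.Theorems.WardSlot
open scoped ComplexOrder BigOperators

/-! ##### (f) LOCAL base shard (T16 `rhsPolyL`, zero-filtered pipe `canonNFZV`) under the R-blocks — the path of record -/

/-- The well-formedness of the expansion `K♯` contains that of the base certificate. -/
theorem wellFormed_toSymCert_of_expand (K : SymCertR) (h : wellFormed K.expand = true) :
    wellFormed K.toSymCert = true := by
  have h' := h
  simp only [wellFormed, SymCertR.expand, Bool.and_eq_true] at h' ⊢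
  obtain ⟨⟨⟨⟨⟨⟨⟨⟨⟨⟨⟨⟨⟨hnd, hz0⟩, hn0⟩, hIF⟩, hth⟩, hgram⟩, hgM⟩, heom⟩, hmov⟩, hch⟩, hwp⟩, hwm⟩, hah⟩, hsl⟩ := h'
  refine ⟨⟨⟨⟨⟨⟨⟨⟨⟨⟨⟨⟨⟨hnd, hz0⟩, hn0⟩, hIF⟩, hth⟩, hgram⟩, ?_⟩, heom⟩, hmov⟩, hch⟩, hwp⟩, hwm⟩, hah⟩, hsl⟩
  rw [List.all_eq_true] at hgM ⊢
  exact fun B hB => hgM B (List.mem_append_left _ hB)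

/-- **LOCAL R-shard list**: T16b's local shards of the base certificate (local base shard, `gramM` row chunks), then the
R-block representative chunks. -/
def shardPolysRL (K : SymCertR) (c : ℕ) : List QPoly :=
  shardPolysL K.toSymCert c ++ K.gramR.flatMap (blockShardPolysR c)

/-- The local R-shards have the same operator sum as the R-shards (in any window containing the frame). -/
theorem sum_shardPolysRL {Λ' : Finset (Site 2)} (K : SymCertR) (hwf : wellFormed K.toSymCert = true)
    (hFL : K.frame.toFinset ⊆ Λ') (c : ℕ) :
    ((shardPolysRL K c).map (polyOp Λ')).sum = ((shardPolysR K c).map (polyOp Λ')).sum := by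
  rw [shardPolysRL, shardPolysR, List.map_append, List.sum_append, List.map_append, List.sum_append,
    sum_shardPolysL K.toSymCert hwf hFL c, sum_shardPolys]

/-- **Local R-shard `j`, computed alone**: T16b's `shardPolyAtLFast` on the base certificate, then the R-block walk. -/
def shardPolyAtRLFast (K : SymCertR) (c j : ℕ) : QPoly :=
  if j < shardCount K.toSymCert c then shardPolyAtLFast K.toSymCert c j
  else shardsFromR c K.gramR (j - shardCount K.toSymCert c)

/-- The fast local accessor agrees with indexing `shardPolysRL`. -/
theorem shardPolyAtRLFast_eq (K : SymCertR) (c j : ℕ) :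
    shardPolyAtRLFast K c j = ((shardPolysRL K c)[j]?).getD [] := by
  unfold shardPolyAtRLFast shardPolysRL
  split_ifs with h
  · rw [shardPolyAtLFast_eq, List.getElem?_append_left (by rwa [← shardCount_eq_lengthL])]
  · rw [List.getElem?_append_right (by rw [← shardCount_eq_lengthL]; omega), ← shardCount_eq_lengthL, shardsFromR_eq]

/-- `shardCountR` also counts the local R-shards. -/
theorem shardCountR_eq_lengthRL (K : SymCertR) (c : ℕ) : shardCountR K c = (shardPolysRL K c).length := by
  rw [shardCountR, shardPolysRL, List.length_append, shardCount_eq_lengthL, List.length_flatMap]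
  congr 2
  exact List.map_congr_left fun B _ => (length_blockShardPolysR c B).symm

/-- **What ONE farm call proves about local R-shard `j`** (zero-filtered executed pipe of T16b). -/
def shardOKRLV (K : SymCertR) (c j : ℕ) (P : QPoly) : Bool :=
  psuppIn P K.frame && isZero (psub (canonNFZV K.frame (shardPolyAtRLFast K c j)) P)

/-- The per-call facts, local executed form (structural on the literal partial list). -/
def ShardFactsRLV (K : SymCertR) (c : ℕ) : ℕ → List QPoly → Prop
  | _, [] => True
  | j, P :: Ps => shardOKRLV K c j P = true ∧ ShardFactsRLV K c (j + 1) Ps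

/-- Index-based local R-facts give T16b's two-list facts `Facts₂Z` on the corresponding suffix of `shardPolysRL`. -/
theorem facts₂Z_of_shardFactsRLV (K : SymCertR) (c : ℕ) :
    ∀ (Ps : List QPoly) (j : ℕ), ((shardPolysRL K c).drop j).length = Ps.length →
      ShardFactsRLV K c j Ps → Facts₂Z K.toSymCert ((shardPolysRL K c).drop j) Ps
  | [], j, hl, _ => by
    rw [List.length_nil, List.length_eq_zero_iff] at hl
    rw [hl]; trivial
  | P :: Ps, j, hl, hf => by
    have hj : j < (shardPolysRL K c).length := by
      rw [List.length_drop, List.length_cons] at hl; omega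
    rw [List.drop_eq_getElem_cons hj]
    have hQ : shardPolyAtRLFast K c j = (shardPolysRL K c)[j] := by
      rw [shardPolyAtRLFast_eq, List.getElem?_eq_getElem hj]; rfl
    refine ⟨?_, facts₂Z_of_shardFactsRLV K c Ps (j + 1) ?_ hf.2⟩
    · rw [← hQ]; exact hf.1
    · have := hl; rw [List.drop_eq_getElem_cons hj, List.length_cons, List.length_cons] at this; omega

/-- **GENERIC SOUNDNESS OF AN R-SHARD LIST** (the one proof behind every sharded R-closing below): any list `Qs` of
frame-supported polynomials whose operator sum is `LHS − RHS_R` in every window containing the frame, with two-list facts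
`Facts₂Z` against shipped partials `Ps` whose concatenation canonicalises to zero, certifies `WardD4CertGe (symValueR K)` —
given the R-blocks' side conditions.  Proof = the `…GramRShards` assembly: derived use family (shard canon uses ++ final canon
uses ++ negated block uses), envelope of `K♯`, `facts₂Z_sum`, `canonNFZV_expansion`, `polyOp_rhsPoly_expand`,
`wardD4CertGe_of_expansion K♯`. -/
theorem wardD4CertGe_of_facts₂ZR (K : SymCertR) (hwf0 : wellFormed K.expand = true)
    (hRok : K.gramR.all (gramBlockROK K.frame) = true) (Qs Ps : List QPoly)
    (hQ : ∀ Q ∈ Qs, PSupp Q K.frame.toFinset)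
    (hsumQ : ∀ Λ' : Finset (Site 2), K.frame.toFinset ⊆ Λ' →
      (Qs.map (polyOp Λ')).sum = polyOp Λ' (lhsPoly K.toSymCert) - polyOp Λ' (rhsPolyR K))
    (hF : Facts₂Z K.toSymCert Qs Ps) (hfin : isZero (canonNFZV K.frame Ps.flatten) = true) :
    WardD4CertGe ((symValueR K : ℚ) : ℝ) := by
  have hRok' : ∀ B ∈ K.gramR, gramBlockROK K.frame B = true := List.all_eq_true.1 hRok
  have hsD : ∀ B ∈ K.gramR, (∀ s ∈ B.reps, PSupp s K.frame.toFinset) ∧ ∀ q ∈ genBasis B, PSupp q K.frame.toFinset :=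
    fun B hB => ⟨fun s hs => ((gramBlockROK_spec (hRok' B hB)).1 s hs).1, fun q hq => by
      rw [genBasis, List.mem_map] at hq
      obtain ⟨s, hs, rfl⟩ := hq
      exact PSupp_genOne ((gramBlockROK_spec (hRok' B hB)).1 s hs).2⟩
  /- the DERIVED use family and its envelope -/
  let U := (Qs.flatMap (canonNFZUses K.frame) ++ canonNFZUses K.frame Ps.flatten) ++
    (K.gramR.flatMap blockUses).map negUse
  have hL : (envelope K.expand U).toList.toFinset = envelope K.expand U := Finset.toList_toFinset _
  have hFL : K.frame.toFinset ⊆ (envelope K.expand U).toList.toFinset := by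
    rw [hL]; exact (subset_thicken _ 1).trans (thicken_subset_envelope K.expand U)
  obtain ⟨hsum, hPs⟩ := facts₂Z_sum K.toSymCert hFL Qs Ps hF hQ
  have hU : ∀ e ∈ U, SuppIn e.u K.expand.frame.toFinset := by
    intro e he
    rcases List.mem_append.1 he with he | he
    · rcases List.mem_append.1 he with he | he
      · rw [List.mem_flatMap] at he
        obtain ⟨Q, hQ', he⟩ := he
        exact canonNFZUses_supp K.frame Q (hQ Q hQ') e he
      · exact canonNFZUses_supp K.frame _ hPs e he
    · rw [List.mem_map] at he
      obtain ⟨e', he', rfl⟩ := he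
      rw [List.mem_flatMap] at he'
      obtain ⟨B, hB, he'⟩ := he'
      rw [blockUses, List.mem_flatMap] at he'
      obtain ⟨m, -, he'⟩ := he'
      obtain ⟨t, ht, hu⟩ := polyUses_u he'
      show SuppIn e'.u K.frame.toFinset
      rw [hu]
      exact PSupp_gramBlockPolyR B (hsD B hB).1 (hsD B hB).2 t ht
  refine wardD4CertGe_of_expansion K.expand hwf0 U hU ?_
  /- the expansion -/
  have hBL : ∀ B ∈ K.gramR, (∀ s ∈ B.reps, PSupp (genPre B.moves s) (envelope K.expand U).toList.toFinset) ∧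
      ∀ q ∈ genBasis B, ∀ m ∈ B.moves,
        PSupp (movePolyF m.γ m.v q) (envelope K.expand U).toList.toFinset ∧
          isZero (psub (nfPoly (movePolyF m.γ m.v q)) (pscale m.χ q)) = true := fun B hB =>
    ⟨fun s hs => (((gramBlockROK_spec (hRok' B hB)).1 s hs).2).mono hFL,
      fun q hq m hm => ⟨((gramBlockROK_spec (hRok' B hB)).2 q hq m hm).1.mono hFL,
        ((gramBlockROK_spec (hRok' B hB)).2 q hq m hm).2⟩⟩
  have h2 := polyOp_rhsPoly_expand (envelope K.expand U).toList.toFinset K hBL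
  have hfinal := canonNFZV_expansion K.frame hFL Ps.flatten (hPs.mono hFL)
  rw [polyOp_eq_zero_of_isZero _ _ hfin, zero_add] at hfinal
  rw [hsumQ _ hFL] at hsum
  have hl : lhsPoly K.expand = lhsPoly K.toSymCert := rfl
  have hneg : (((K.gramR.flatMap blockUses).map negUse).map (useOp (envelope K.expand U).toList.toFinset)).sum =
      -((K.gramR.flatMap blockUses).map (useOp (envelope K.expand U).toList.toFinset)).sum := by
    rw [List.map_map, ← list_sum_map_neg]
    simp only [Function.comp_def, useOp_negUse]
  rw [hl, h2, List.map_append, List.sum_append, List.map_append, List.sum_append, ← hfinal, hneg,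
    sub_eq_iff_eq_add.1 hsum]
  abel

/-- The R-blocks' representatives and generated bases are supported in the frame (from the side conditions). -/
theorem supp_of_gramROK (K : SymCertR) (hRok : K.gramR.all (gramBlockROK K.frame) = true) :
    ∀ B ∈ K.gramR, (∀ s ∈ B.reps, PSupp s K.frame.toFinset) ∧ ∀ q ∈ genBasis B, PSupp q K.frame.toFinset :=
  fun B hB => ⟨fun s hs => ((gramBlockROK_spec (List.all_eq_true.1 hRok B hB)).1 s hs).1, fun q hq => by
    rw [genBasis, List.mem_map] at hq
    obtain ⟨s, hs, rfl⟩ := hq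
    exact PSupp_genOne ((gramBlockROK_spec (List.all_eq_true.1 hRok B hB)).1 s hs).2⟩

/-- T16b's local shards of the base certificate are supported in the frame. -/
theorem PSupp_shardPolysL (K : SymCert) (hwf : wellFormed K = true) (c : ℕ) :
    ∀ Q ∈ shardPolysL K c, PSupp Q K.frame.toFinset := by
  have hgM' : ∀ B ∈ K.gramM, ∀ q ∈ B.basis, PSupp q K.frame.toFinset := fun B hB q hq => by
    have hwf' := hwf
    simp only [wellFormed, Bool.and_eq_true] at hwf'
    obtain ⟨⟨⟨⟨⟨⟨⟨⟨⟨⟨⟨⟨⟨-, -⟩, -⟩, -⟩, -⟩, -⟩, hgM⟩, -⟩, -⟩, -⟩, -⟩, -⟩, -⟩, -⟩ := hwf'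
    have h := List.all_eq_true.1 hgM B hB
    simp only [gramBlockOK, Bool.and_eq_true, List.all_eq_true] at h
    exact PSupp_of_psuppIn (h.2 q hq)
  intro Q hQ
  rw [shardPolysL, List.mem_cons] at hQ
  rcases hQ with rfl | hQ
  · exact (PSupp_lhsPoly K (thicken_zero_subset_of_wellFormed K hwf)).psub (PSupp_rhsNonBlockL K hwf)
  · rw [List.mem_flatMap] at hQ
    obtain ⟨B, hB, hQ⟩ := hQ
    exact PSupp_blockShardPolys c B (hgM' B hB) Q hQ

/-- **SHARDED LOCAL R-REPLAY IS SOUND**: T16b's sharded local replay (`rhsPolyL` base, zero filter) with the R-blocks'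
representative chunks appended; the R-blocks' side conditions `hRok` as in `…GramRShards` (or assembled per block by
`gramR_all_of_facts`). -/
theorem wardD4CertGe_of_shardsRLV (K : SymCertR) (hwf0 : wellFormed K.expand = true)
    (hRok : K.gramR.all (gramBlockROK K.frame) = true) (c : ℕ) (Ps : List QPoly)
    (hcount : shardCountR K c = Ps.length) (hfacts : ShardFactsRLV K c 0 Ps)
    (hfin : isZero (canonNFZV K.frame Ps.flatten) = true) : WardD4CertGe ((symValueR K : ℚ) : ℝ) := by
  have hwfb : wellFormed K.toSymCert = true := wellFormed_toSymCert_of_expand K hwf0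
  have hsD := supp_of_gramROK K hRok
  have hQ : ∀ Q ∈ shardPolysRL K c, PSupp Q K.frame.toFinset := by
    intro Q hQ
    rcases List.mem_append.1 hQ with hQ | hQ
    · exact PSupp_shardPolysL K.toSymCert hwfb c Q hQ
    · rw [List.mem_flatMap] at hQ
      obtain ⟨B, hB, hQ⟩ := hQ
      exact PSupp_blockShardPolysR c B (hsD B hB).1 (hsD B hB).2 Q hQ
  have hlen : (shardPolysRL K c).length = Ps.length := (shardCountR_eq_lengthRL K c).symm.trans hcount
  have hF : Facts₂Z K.toSymCert (shardPolysRL K c) Ps := by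
    have h := facts₂Z_of_shardFactsRLV K c Ps 0 (by rw [List.drop_zero]; exact hlen) hfacts
    rwa [List.drop_zero] at h
  exact wardD4CertGe_of_facts₂ZR K hwf0 hRok _ Ps hQ
    (fun Λ' hFL => by rw [sum_shardPolysRL K hwfb hFL, sum_shardPolysR]) hF hfin

/-- **Sharded LOCAL R-replay, closing theorem**: `symValueR K ≤ e₀(1,0,8,7/8)`.  CLOSING GRAMMAR (path of record for an
R-literal on v0′/E₁): per shard `j < shardCountR K c` one theorem `shard_j : shardOKRLV K c j P_j = true := by
native_decide`; per R-block `rok_i : gramROKAt K i = true := by native_decide`; then `hwf : wellFormed K.expand = true`,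
`hcount : shardCountR K c = m + 1`, `hRok := gramR_all_of_facts K n (by native_decide) ⟨rok_0, …, trivial⟩`,
`hfacts : ShardFactsRLV K c 0 [P₀, …, P_m] := ⟨shard_0, …, shard_m, trivial⟩`,
`hfin : isZero (canonNFZV K.frame [P₀, …].flatten) = true`. -/
theorem energyDensity_ge_of_shardsRLV (K : SymCertR) (hwf : wellFormed K.expand = true)
    (hRok : K.gramR.all (gramBlockROK K.frame) = true) (c : ℕ) (Ps : List QPoly)
    (hcount : shardCountR K c = Ps.length) (hfacts : ShardFactsRLV K c 0 Ps)
    (hfin : isZero (canonNFZV K.frame Ps.flatten) = true) :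
    ((symValueR K : ℚ) : ℝ) ≤ energyDensityTT' 1 0 8 (7 / 8) :=
  energyDensity_ge_of_windowSound_cert _ WardSlot.stub_wardWindowSound
    (wardD4CertGe_of_shardsRLV K hwf hRok c Ps hcount hfacts hfin)

/-! ##### (g) Kernel demo: `toyRCert` through the LOCAL sharded R-pipe end to end -/

/-- The toy's local R-shard partials (zero-filtered canonical forms of the three local R-shards). -/
def toyRLPartials : List QPoly :=
  [canonNFZV toyRCert.frame (shardPolyAtRLFast toyRCert 0 0), canonNFZV toyRCert.frame (shardPolyAtRLFast toyRCert 0 1),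
    canonNFZV toyRCert.frame (shardPolyAtRLFast toyRCert 0 2)]

/-- End to end on the toy: `−11/4 = symValueR toyRCert ≤ e₀(1,0,8,7/8)` through `energyDensity_ge_of_shardsRLV`
(every hypothesis by `decide +kernel`; standard axioms). -/
theorem toyRCert_energy_ge_local : ((symValueR toyRCert : ℚ) : ℝ) ≤ energyDensityTT' 1 0 8 (7 / 8) :=
  energyDensity_ge_of_shardsRLV toyRCert (by decide +kernel)
    (gramR_all_of_facts toyRCert 2 (by decide +kernel) ⟨by decide +kernel, by decide +kernel, trivial⟩) 0 toyRLPartials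
    (by decide +kernel) ⟨by decide +kernel, by decide +kernel, by decide +kernel, trivial⟩ (by decide +kernel)

/-- Non-vacuity: no single local R-shard of the toy closes against the empty partial. -/
example : shardOKRLV toyRCert 0 0 [] = false ∧ shardOKRLV toyRCert 0 2 [] = false := by decide +kernel

/-! ##### (h) GROUPED R-shards — runs of consecutive R-blocks as ONE shard each (few shards `J` ⇒ few shipped partial literals;
hub-lb-sym-plan-1 PARTIALS-BYTES: the partial literals are the dominant byte item of a sharded landing and `J` is the lever) -/

/-- Split a list into consecutive runs of the given sizes; whatever the sizes leave over is the LAST run (so the runs always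
re-assemble the list, with no side condition; `sizes.length + 1` runs). The converter orders the R-blocks freely, so runs of a
shipped `sizes` list realise any grouping. -/
def splitRuns {α : Type} : List ℕ → List α → List (List α)
  | [], l => [l]
  | n :: ns, l => l.take n :: splitRuns ns (l.drop n)

theorem flatten_splitRuns {α : Type} : ∀ (ns : List ℕ) (l : List α), (splitRuns ns l).flatten = l
  | [], l => by simp [splitRuns]
  | n :: ns, l => by rw [splitRuns, List.flatten_cons, flatten_splitRuns ns, List.take_append_drop]

theorem length_splitRuns {α : Type} : ∀ (ns : List ℕ) (l : List α), (splitRuns ns l).length = ns.length + 1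
  | [], l => rfl
  | n :: ns, l => by rw [splitRuns, List.length_cons, length_splitRuns ns, List.length_cons]

/-- Run `i` computed alone (only `take`/`drop` walking; no other run is built). -/
def runAt {α : Type} : List ℕ → List α → ℕ → List α
  | [], l, 0 => l
  | [], _, _ + 1 => []
  | n :: _, l, 0 => l.take n
  | n :: ns, l, i + 1 => runAt ns (l.drop n) i

theorem runAt_eq {α : Type} : ∀ (ns : List ℕ) (l : List α) (i : ℕ), runAt ns l i = ((splitRuns ns l)[i]?).getD []
  | [], l, 0 => by simp [runAt, splitRuns]
  | [], l, i + 1 => by simp [runAt, splitRuns]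
  | n :: ns, l, 0 => by simp [runAt, splitRuns]
  | n :: ns, l, i + 1 => by rw [runAt, splitRuns, List.getElem?_cons_succ]; exact runAt_eq ns _ i

/-- The GROUP shard of a run of R-blocks: all their (negated, scaled) representative row chunks concatenated. -/
def groupShardR (c : ℕ) (Bs : List GramBlockR) : QPoly := (Bs.flatMap (blockShardPolysR c)).flatten

theorem polyOp_flatten_eq_sum (Λ' : Finset (Site 2)) : ∀ (l : List QPoly), polyOp Λ' l.flatten = (l.map (polyOp Λ')).sum
  | [] => by simp
  | p :: l => by rw [List.flatten_cons, polyOp_append, polyOp_flatten_eq_sum Λ' l, List.map_cons, List.sum_cons]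

theorem polyOp_groupShardR (Λ' : Finset (Site 2)) (c : ℕ) (Bs : List GramBlockR) :
    polyOp Λ' (groupShardR c Bs) = -polyOp Λ' (Bs.flatMap fun B => pscale (B.moves.length : ℚ) (gramBlockPolyR B)) := by
  rw [groupShardR, polyOp_flatten_eq_sum, sum_flatMap_blockShardPolysR]

theorem PSupp_groupShardR (c : ℕ) (Bs : List GramBlockR) {Λ : Finset (Site 2)}
    (h : ∀ B ∈ Bs, (∀ s ∈ B.reps, PSupp s Λ) ∧ ∀ q ∈ genBasis B, PSupp q Λ) : PSupp (groupShardR c Bs) Λ := by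
  intro t ht
  rw [groupShardR, List.mem_flatten] at ht
  obtain ⟨Q, hQ, ht⟩ := ht
  rw [List.mem_flatMap] at hQ
  obtain ⟨B, hB, hQ⟩ := hQ
  exact PSupp_blockShardPolysR c B (h B hB).1 (h B hB).2 Q hQ t ht

/-- **GROUPED local R-shard list**: T16b's local shards of the base certificate, then ONE shard per run of R-blocks. -/
def shardPolysRG (K : SymCertR) (c : ℕ) (sizes : List ℕ) : List QPoly :=
  shardPolysL K.toSymCert c ++ (splitRuns sizes K.gramR).map (groupShardR c)

theorem sum_shardPolysRG {Λ' : Finset (Site 2)} (K : SymCertR) (hwf : wellFormed K.toSymCert = true)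
    (hFL : K.frame.toFinset ⊆ Λ') (c : ℕ) (sizes : List ℕ) :
    ((shardPolysRG K c sizes).map (polyOp Λ')).sum = polyOp Λ' (lhsPoly K.toSymCert) - polyOp Λ' (rhsPolyR K) := by
  have hruns : ∀ L : List (List GramBlockR), ((L.map (groupShardR c)).map (polyOp Λ')).sum =
      -polyOp Λ' (L.flatten.flatMap fun B => pscale (B.moves.length : ℚ) (gramBlockPolyR B)) := by
    intro L
    induction L with
    | nil => simp
    | cons Bs L ih =>
      rw [List.map_cons, List.map_cons, List.sum_cons, ih, List.flatten_cons, List.flatMap_append, polyOp_append,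
        polyOp_groupShardR, neg_add]
  rw [shardPolysRG, List.map_append, List.sum_append, sum_shardPolysL K.toSymCert hwf hFL c, hruns, flatten_splitRuns,
    rhsPolyR, polyOp_append]
  abel

/-- **Grouped local R-shard `j`, computed alone.** -/
def shardPolyAtRGFast (K : SymCertR) (c : ℕ) (sizes : List ℕ) (j : ℕ) : QPoly :=
  if j < shardCount K.toSymCert c then shardPolyAtLFast K.toSymCert c j
  else groupShardR c (runAt sizes K.gramR (j - shardCount K.toSymCert c))

theorem shardPolyAtRGFast_eq (K : SymCertR) (c : ℕ) (sizes : List ℕ) (j : ℕ) :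
    shardPolyAtRGFast K c sizes j = ((shardPolysRG K c sizes)[j]?).getD [] := by
  unfold shardPolyAtRGFast shardPolysRG
  split_ifs with h
  · rw [shardPolyAtLFast_eq, List.getElem?_append_left (by rwa [← shardCount_eq_lengthL])]
  · rw [List.getElem?_append_right (by rw [← shardCount_eq_lengthL]; omega), ← shardCount_eq_lengthL, runAt_eq,
      List.getElem?_map]
    cases (splitRuns sizes K.gramR)[j - shardCount K.toSymCert c]? with
    | none => rfl
    | some Bs => rfl

/-- Number of grouped shards, cheaply: base shards + `sizes.length + 1` runs. -/
def shardCountRG (K : SymCertR) (c : ℕ) (sizes : List ℕ) : ℕ := shardCount K.toSymCert c + (sizes.length + 1)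

theorem shardCountRG_eq (K : SymCertR) (c : ℕ) (sizes : List ℕ) :
    shardCountRG K c sizes = (shardPolysRG K c sizes).length := by
  rw [shardCountRG, shardPolysRG, List.length_append, shardCount_eq_lengthL, List.length_map, length_splitRuns]

/-- **What ONE farm call proves about grouped shard `j`** (zero-filtered executed pipe). -/
def shardOKRGV (K : SymCertR) (c : ℕ) (sizes : List ℕ) (j : ℕ) (P : QPoly) : Bool :=
  psuppIn P K.frame && isZero (psub (canonNFZV K.frame (shardPolyAtRGFast K c sizes j)) P)

/-- The per-call facts, grouped form (structural on the literal partial list). -/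
def ShardFactsRGV (K : SymCertR) (c : ℕ) (sizes : List ℕ) : ℕ → List QPoly → Prop
  | _, [] => True
  | j, P :: Ps => shardOKRGV K c sizes j P = true ∧ ShardFactsRGV K c sizes (j + 1) Ps

theorem facts₂Z_of_shardFactsRGV (K : SymCertR) (c : ℕ) (sizes : List ℕ) :
    ∀ (Ps : List QPoly) (j : ℕ), ((shardPolysRG K c sizes).drop j).length = Ps.length →
      ShardFactsRGV K c sizes j Ps → Facts₂Z K.toSymCert ((shardPolysRG K c sizes).drop j) Ps
  | [], j, hl, _ => by
    rw [List.length_nil, List.length_eq_zero_iff] at hl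
    rw [hl]; trivial
  | P :: Ps, j, hl, hf => by
    have hj : j < (shardPolysRG K c sizes).length := by
      rw [List.length_drop, List.length_cons] at hl; omega
    rw [List.drop_eq_getElem_cons hj]
    have hQ : shardPolyAtRGFast K c sizes j = (shardPolysRG K c sizes)[j] := by
      rw [shardPolyAtRGFast_eq, List.getElem?_eq_getElem hj]; rfl
    refine ⟨?_, facts₂Z_of_shardFactsRGV K c sizes Ps (j + 1) ?_ hf.2⟩
    · rw [← hQ]; exact hf.1
    · have := hl; rw [List.drop_eq_getElem_cons hj, List.length_cons, List.length_cons] at this; omega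

/-- **GROUPED SHARDED LOCAL R-REPLAY IS SOUND.** -/
theorem wardD4CertGe_of_shardsRGV (K : SymCertR) (hwf0 : wellFormed K.expand = true)
    (hRok : K.gramR.all (gramBlockROK K.frame) = true) (c : ℕ) (sizes : List ℕ) (Ps : List QPoly)
    (hcount : shardCountRG K c sizes = Ps.length) (hfacts : ShardFactsRGV K c sizes 0 Ps)
    (hfin : isZero (canonNFZV K.frame Ps.flatten) = true) : WardD4CertGe ((symValueR K : ℚ) : ℝ) := by
  have hwfb : wellFormed K.toSymCert = true := wellFormed_toSymCert_of_expand K hwf0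
  have hsD := supp_of_gramROK K hRok
  have hQ : ∀ Q ∈ shardPolysRG K c sizes, PSupp Q K.frame.toFinset := by
    intro Q hQ
    rcases List.mem_append.1 hQ with hQ | hQ
    · exact PSupp_shardPolysL K.toSymCert hwfb c Q hQ
    · rw [List.mem_map] at hQ
      obtain ⟨Bs, hBs, rfl⟩ := hQ
      refine PSupp_groupShardR c Bs fun B hB => hsD B ?_
      rw [← flatten_splitRuns sizes K.gramR, List.mem_flatten]
      exact ⟨Bs, hBs, hB⟩
  have hlen : (shardPolysRG K c sizes).length = Ps.length := (shardCountRG_eq K c sizes).symm.trans hcount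
  have hF : Facts₂Z K.toSymCert (shardPolysRG K c sizes) Ps := by
    have h := facts₂Z_of_shardFactsRGV K c sizes Ps 0 (by rw [List.drop_zero]; exact hlen) hfacts
    rwa [List.drop_zero] at h
  exact wardD4CertGe_of_facts₂ZR K hwf0 hRok _ Ps hQ (fun Λ' hFL => sum_shardPolysRG K hwfb hFL c sizes) hF hfin

/-- **Grouped sharded local R-replay, closing theorem.**  CLOSING GRAMMAR: as `energyDensity_ge_of_shardsRLV` with the extra
literal `sizes` (run lengths over the shipped R-block order; `J = sizes.length + 1` Gram shards), shard facts
`shardOKRGV K c sizes j P_j` and `hcount : shardCountRG K c sizes = m + 1`. -/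
theorem energyDensity_ge_of_shardsRGV (K : SymCertR) (hwf : wellFormed K.expand = true)
    (hRok : K.gramR.all (gramBlockROK K.frame) = true) (c : ℕ) (sizes : List ℕ) (Ps : List QPoly)
    (hcount : shardCountRG K c sizes = Ps.length) (hfacts : ShardFactsRGV K c sizes 0 Ps)
    (hfin : isZero (canonNFZV K.frame Ps.flatten) = true) :
    ((symValueR K : ℚ) : ℝ) ≤ energyDensityTT' 1 0 8 (7 / 8) :=
  energyDensity_ge_of_windowSound_cert _ WardSlot.stub_wardWindowSound
    (wardD4CertGe_of_shardsRGV K hwf hRok c sizes Ps hcount hfacts hfin)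

/-! ##### (i) Kernel demo: `toyRCert` through the GROUPED pipe — `sizes = [1]` (runs `[B₀], [B₁]`: the same three shards and
partials as §(g)) and `sizes = []` (ONE run `[B₀, B₁]`: two shards) -/

theorem toyRCert_energy_ge_grouped₁ : ((symValueR toyRCert : ℚ) : ℝ) ≤ energyDensityTT' 1 0 8 (7 / 8) :=
  energyDensity_ge_of_shardsRGV toyRCert (by decide +kernel)
    (gramR_all_of_facts toyRCert 2 (by decide +kernel) ⟨by decide +kernel, by decide +kernel, trivial⟩) 0 [1] toyRLPartials
    (by decide +kernel) ⟨by decide +kernel, by decide +kernel, by decide +kernel, trivial⟩ (by decide +kernel)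

/-- One Gram group: partials = the base partial and the canonical form of the whole R part. -/
def toyRGPartials : List QPoly :=
  [canonNFZV toyRCert.frame (shardPolyAtRGFast toyRCert 0 [] 0), canonNFZV toyRCert.frame (shardPolyAtRGFast toyRCert 0 [] 1)]

theorem toyRCert_energy_ge_grouped₀ : ((symValueR toyRCert : ℚ) : ℝ) ≤ energyDensityTT' 1 0 8 (7 / 8) :=
  energyDensity_ge_of_shardsRGV toyRCert (by decide +kernel)
    (gramR_all_of_facts toyRCert 2 (by decide +kernel) ⟨by decide +kernel, by decide +kernel, trivial⟩) 0 [] toyRGPartials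
    (by decide +kernel) ⟨by decide +kernel, by decide +kernel, trivial⟩ (by decide +kernel)

/-- Fewer shards, fewer shipped terms (the byte law on the toy): the grouped partial list is no longer than the per-block one. -/
example : (toyRGPartials.map List.length).sum ≤ (toyRLPartials.map List.length).sum := by decide +kernel

end Summit.Ventures.CertifiedManyBodySolver.Theorems.SymReplay
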